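import Summits.QuantumFields.YangMills.Theorems.BalabanUVNodesN05SubBP2DSlotExistsLawLanGammaPrime
import Summits.QuantumFields.YangMills.Theorems.BalabanUVNodesN05AtXPinnedP2DSViewSepCoPH

/-!
# BalabanUVNodes ∕ N05 ([B8], `Dag.B8_main`) AT THE K1 ENGINE'S FOUR-PIN X-P₂D VIEW — PRINT'S BACKGROUND (v1.7 key `SepCoPH`), «P₂D» PIN, SC-BINDING: N05 IN ∃-CURRENCY AT THE
# RECORD `Node00.IsRecordOfRecord₁₃CSepCoPHSX3P₂DV` FED BY THE FIVE (1.5)-KEYED [4]-TYPE FAMILIES ALONE — the X-view record image of dag-n05-d g12's ∃λ theorem (11)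
# `BalabanUVNodesN05SubBP2DSlotExistsLawLanGammaPrime.exists_residB8_b8LeafOfRecordSubBP₂D_cutSubBP₅_of_lettersSrc_γ'` (p619291; the layer CUT AT dag-n05-w1's P₅-PIN
# `λ.cutSubBP₅ c₁ ρ₀`, p618280 — Proposition 5's family = print's p. 94 family BY NAME) through this seat's X-view slot closer
# `…N05AtXPinnedP2DSViewSepCoPH.exists_isRecordOfRecord₁₃CSepCoPHSX3P₂DV_b8_of_leaf` (sibling of `…N05AtRecord13SubBP2DSepCoPHOfSocketsGammaPrime`, the one-pin CoPH image)

Track A of `YM-PLAN.md` (cell `pub-ymgap`, HUMAN RULING D-0062 ∕ D-0149 width seats), node **N05** = [Balaban1985RegularSpaces] Lemma 1, Thm 2, Prop 3, Thm 4, Props 5–7,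
Thm 8; width seat `pub-ymgap-dag-n05-w4` (g3), 2026-08-28, key item K1⁸ `StabilityBRunRowsAtRecordR13SepCoPH` (dag-lead KEY MAP v1.65; `--supports`, helper; count-neutral).

* ★ `exists_isRecordOfRecord₁₃CSepCoPHSX3P₂DV_b8_of_lettersSrc_γ'` — for `θ : Stage13HParams F N` with `Provisos₁₃SepCoPH`, `Admissible`, `5 ≤ L`, ANY `lam12 lam13 Mstar ops ζ lamW`
  ([B12] ∕ [B13] groups, B10 ∕ Y ∕ Z ∕ W pins), any window `0 < γw ≤ θ.γ`, and (11)'s hypotheses VERBATIM over `θ.toStage3Params` ([Balaban1985BackgroundPropagators]'s primitive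
  constants, the letters `SLet ∕ SLetUB` and the b9 sockets `SB9P ∕ SH59src ∕ SB9srcHP` at the (1.3)–(1.5)-ADMISSIBLE `Ω₀ = ℤᵈ` law members — HYPOTHESES; Theorem 8's socket-side
  constants and the guard `2 ≤ 5dLB₀`): `∃ lam c₁ ρ₀ w w′` — the engine-shaped record `IsRecordOfRecord₁₃CSepCoPHSX3P₂DV F N (datumOfRecord₁₃SepCoPH F N θ h) w` bound by
  `upOfRecord₅CSC` over `(θ.pinX3P₂D (lam.cutSubBP₅ c₁ ρ₀) lam12 lam13).view₁₃CoPHB10YZW Mstar ops ζ lamW`, `w.C ∕ w.γ = γw ∕ w.L`, EVERY run's `b8` leaf and `Dag.B8_main`, and the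
  same-datum `₁₃CSepCoPH` companion `w′` (leaves equal off `b8`).  Proof: `obtain` (11) + `exact` the X-view closer.  (The record is a member of the `b8`-generic S-class by
  `Node00.isRecordOfRecord₁₃CSepCoPHG_of_isRecordOfRecord₁₃CSepCoPHSX3P₂DV`, p621198.)
NO `p5e p5u p6 p7 t8 …` is displayed: Proposition 5 is read on print's p. 94 family at the P₅-pin, Proposition 6 at print's cube of record, Proposition 7 in the repaired currency,
Theorem 8 knit in — all INSIDE (11); what remains displayed is N06 content.

HONEST FRAMING: kernel bookkeeping by name (`obtain` + `exact`); NO estimate; nothing of [Balaban1985RegularSpaces] ∕ [Balaban1985BackgroundPropagators] asserted — the five [4]-type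
families are HYPOTHESES (N06 content at `m ≥ 1`, OPEN; satisfiability class-wise NOT claimed; no positive A6 witness at m ≥ 1 claimed); ∃-currency over the layer AND the world; `5 ≤ L`
a guard on the presenting parameter; Proposition 7 inside the slot in the repaired currency `c₇OfRecord θ₃` (WEAKER than print's `2α₂`, WATCH-P7-CURRENCY-RECORD); whether an engine
edition reads this world is dag-n24's ∕ the plan's word; count-neutral; **N05 NOT discharged**; K1 NOT claimed; no count claim; Bałaban AS PRINTED with locators; one finite 𝕋⁴
programme at fixed ε — the Yang–Mills mass gap (Clay) is NOT proved by any of this; R4 closes the conditional finite-𝕋⁴ rung `BalabanLadder.UV` only; nothing continuum ∕ ℝ⁴ ∕ OS.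
No `sorry`, no new definition, no `instance`, no `notation`.  Unit `pub-ymgap-dag-n05-w4` (g3), 2026-08-28.
[cite: Balaban1985RegularSpaces, Lemma 1 p.79, Thm 2 p.83, Prop. 3 p.87, Thm 4 p.88, Prop. 5 (1.106)–(1.110) p.94, Prop. 6 (1.131)–(1.138) pp.98–99, Prop. 7 (1.144)–(1.145) p.100, (1.3)–(1.5) p.77, Thm 8 (1.146) p.101; Balaban1985BackgroundPropagators, Thm 3.1 p.397, Thm 3.3 p.398, (3.40) p.397 (hypotheses); Balaban1989LargeFieldII, Thm 1 + (0.1) pp.355–356 (the record, bookkeeping)]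
-/

noncomputable section

namespace Summit.QuantumFields.YangMills.BalabanUVNodes.N05AtXPinnedP2DSViewSepCoPHOfSocketsGammaPrime

open Literature.MathematicalPhysics.QuantumFieldTheory.Balaban1983to89
open Literature.MathematicalPhysics.QuantumFieldTheory.Balaban1983to89.Node00
open Literature.MathematicalPhysics.QuantumFieldTheory.Balaban1983to89.T4Continuum
open Literature.MathematicalPhysics.QuantumFieldTheory.Balaban1983to89.DagBinding
open Literature.MathematicalPhysics.QuantumFieldTheory.Balaban1983to89.B8IdxB8LawsB (IdxB8LawsB IdxB8SubB)
open Literature.MathematicalPhysics.QuantumFieldTheory.Balaban1983to89.B8LeafModelZd (ZdIdx)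
open Literature.MathematicalPhysics.QuantumFieldTheory.Balaban1983to89.B8LeafModelZd3 (SockB9P3)
open Literature.MathematicalPhysics.QuantumFieldTheory.Balaban1983to89.B9SupplySockB9P3ZdGammaUnivDelta2 (SockB9P3H2)
open Literature.MathematicalPhysics.QuantumFieldTheory.Balaban1983to89.B8LeafModelZd3P (zdGF3P zdGF3HP)
open Literature.MathematicalPhysics.QuantumFieldTheory.Balaban1983to89.B8LeafModelZd3P2 (zdGF3P₂ zdGF3HP₂)
open Literature.MathematicalPhysics.QuantumFieldTheory.Balaban1983to89.B8TowerBondsPrinted (towerBondsP)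
open Literature.MathematicalPhysics.QuantumFieldTheory.Balaban1983to89.B8SockLettersRD (SockLettersRD)
open Literature.MathematicalPhysics.QuantumFieldTheory.Balaban1983to89.B8Lemma1NonAbelian (mulCfg blockPairNA)
open Literature.MathematicalPhysics.QuantumFieldTheory.Balaban1983to89.B8LanF146 (LanF146)
open Literature.MathematicalPhysics.QuantumFieldTheory.Balaban1983to89.B8Eq138LandauZd (covLap QT InR138 IsLandau146W)
open Literature.MathematicalPhysics.QuantumFieldTheory.Balaban1983to89.B8Prop5LandauDataZd (ZdLanIdx zdLan)
open Summit.QuantumFields.YangMills.BalabanUVNodes.N05SubBP2DSlotExistsLawLanGammaPrime (exists_residB8_b8LeafOfRecordSubBP₂D_cutSubBP₅_of_lettersSrc_γ')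
open MatrixLog B7Prop1Explicit B7Prop2Explicit B7Prop1Local B7Eq92Concrete
open B8Ineq130 (tlo thi)
open B8Ineq132 (InAk covDerivFwd)
open B7Eq78Linearization (zdBlocking QprimeIter)
open B8Eq119TwistedAxial (bgT Restr129 InAx)
open B8Eq140Level (SideTouches)
open B8Eq1117Concrete (XSpace)
open B8Prop5ContractionKLevel (Bd2)
open B8LambdaSpaceKLevel (wt)
open B8Eq184Proof (gaugeExp cfgExp)
open B8Eq146AExpansion (iEta plaqCovDeriv)
open B8Eq143PlaqExpansion (pdiv)
open B7Prop4GeneralLevels (linCovIter)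
open B8Eq155JBound (Jcur wsup)
open B8ScaledSupNorm (bondNorm msup Bdd)
open B9Eq340HolderZd (hquot AdmPair)
open scoped Matrix.Norms.L2Operator

-- `Site` alone could resolve to the torus sites of `Setup.lean`; re-export the `ℤ^d` sites of `B7Prop1Explicit`.
export B7Prop1Explicit (Site)
open Summit.QuantumFields.YangMills.BalabanUVNodes.N05AtXPinnedP2DSViewSepCoPH (exists_isRecordOfRecord₁₃CSepCoPHSX3P₂DV_b8_of_leaf)

/-! ## N05 in ∃-currency at the engine's four-pin X-P₂D view, from the five (1.5)-keyed [4]-type families (dag-n05-d's (11) ∘ this seat's X-view slot closer), for ANY `lam12 lam13 Mstar ops ζ lamW` -/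

section AtXView

variable {F : T4Family} {N : ℕ} [NeZero N]

/-- ★ **N05 AT THE ENGINE'S FOUR-PIN X-P₂D v1.7 RECORD OF EVERY ADMISSIBLE PARAMETER, FROM THE [4]-TYPE SOCKETS ALONE** (∃-currency over the residual [B8] layer and the
world; [B12] ∕ [B13] groups at ANY `lam12 lam13`, B10 ∕ Y ∕ Z ∕ W pins at ANY `Mstar ops ζ lamW`; same-datum companion): hypotheses = (11)'s VERBATIM over `θ.toStage3Params`;
conclusion: `∃ lam c₁ ρ₀ w w′` — the record `IsRecordOfRecord₁₃CSepCoPHSX3P₂DV F N (datumOfRecord₁₃SepCoPH F N θ h) w` bound by `upOfRecord₅CSC` over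
`(θ.pinX3P₂D (lam.cutSubBP₅ c₁ ρ₀) lam12 lam13).view₁₃CoPHB10YZW Mstar ops ζ lamW`, `w.γ = γw`, every run's `b8` leaf and `Dag.B8_main`, and the `₁₃CSepCoPH` companion.
Proof: (11) ∘ `exists_isRecordOfRecord₁₃CSepCoPHSX3P₂DV_b8_of_leaf`.  Sockets ∕ letters are HYPOTHESES (N06); N05 NOT discharged.
[cite: Balaban1985RegularSpaces, Lemma 1 – Thm 8 pp.79–101, Prop. 5 (1.106)–(1.110) p.94, Thm 8 (1.146) p.101; Balaban1985BackgroundPropagators, Thm 3.1 p.397, Thm 3.3 p.398; Balaban1989LargeFieldII, Thm 1 + (0.1) pp.355–356 (bookkeeping)] -/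
theorem exists_isRecordOfRecord₁₃CSepCoPHSX3P₂DV_b8_of_lettersSrc_γ' (θ : Stage13HParams F N) (h : θ.Provisos₁₃SepCoPH F N) (hθ : θ.Admissible F N)
    (lam12 : ResidB12 F N θ.τ9.M) (lam13 : B12.RunParams → ResidB13 θ.toStage3Params) (Mstar : ℕ) (ops : OpsY N θ.toStage3Params Mstar)
    (ζ : ResidZ F N) (lamW : ResidW F N)
    (hL5 : 5 ≤ θ.toStage3Params.L) {γw : ℝ} (hγ0 : 0 < γw) (hγ1 : γw ≤ θ.γ)
    -- [Balaban1985BackgroundPropagators]'s PRIMITIVE constants read by the sockets: `B₀` (3.40), the Hölder pair `(β, B₀(β₀))` and length function, [4]'s letter bounds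
    {B₀ B₀β β : ℝ} {len : Site θ.toStage3Params.D → ℝ}
    {cB9 B₀'H B₂' BG BR cL : ℝ}
    (hcB9 : 0 < cB9) (hB₀'H : 0 < B₀'H) (hB₂' : 0 ≤ B₂') (hBG : 0 ≤ BG) (hBR : 0 ≤ BR) (hcL : 0 < cL)
    -- [4]'s letters AT THE `Ω₀ = ℤᵈ` LAW MEMBERS ONLY: existence side (laws on print's domains) and uniqueness side
    (SLet : ∀ i : ZdIdx θ.toStage3Params.D θ.toStage3Params.L, i.Ω 0 = Set.univ → IdxB8LawsB θ.toStage3Params.L i → B8ConstraintBonds.DomainSeq θ.toStage3Params.L i.Ω → (∀ l, l < i.k → ∀ z ∈ i.Λs i.k l, ((θ.toStage3Params.L : ℤ) ^ l) • z ∈ B8ConstraintBonds.Lam θ.toStage3Params.L i.Ω l) → SockLettersRD (𝔸 := θ.toStage3Params.𝔸) θ.toStage3Params.L BG BR B₀'H B₂' cL i.η i.k i.Ω i.Λs)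
    (SLetUB : ∀ i : ZdIdx θ.toStage3Params.D θ.toStage3Params.L, i.Ω 0 = Set.univ → IdxB8LawsB θ.toStage3Params.L i → B8ConstraintBonds.DomainSeq θ.toStage3Params.L i.Ω → (∀ l, l < i.k → ∀ z ∈ i.Λs i.k l, ((θ.toStage3Params.L : ℤ) ^ l) • z ∈ B8ConstraintBonds.Lam θ.toStage3Params.L i.Ω l) → ∀ α₀ : ℝ, 0 < α₀ → α₀ ≤ cL → ∀ U₀ : Site θ.toStage3Params.D → Fin θ.toStage3Params.D → θ.toStage3Params.𝔸ˣ, (∀ x κ, U₀ x κ ∈ unitaryUnits θ.toStage3Params.𝔸) →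
      InAk θ.toStage3Params.L i.k i.η α₀ i.Ω U₀ →
      ∃ (g Δ : (Site θ.toStage3Params.D → θ.toStage3Params.𝔸) →ₗ[ℂ] (Site θ.toStage3Params.D → θ.toStage3Params.𝔸)) (q : (Site θ.toStage3Params.D → θ.toStage3Params.𝔸) →ₗ[ℂ] (ℕ → Site θ.toStage3Params.D → θ.toStage3Params.𝔸))
        (qs : (ℕ → Site θ.toStage3Params.D → θ.toStage3Params.𝔸) →ₗ[ℂ] (Site θ.toStage3Params.D → θ.toStage3Params.𝔸)) (Aw c : (ℕ → Site θ.toStage3Params.D → θ.toStage3Params.𝔸) →ₗ[ℂ] (ℕ → Site θ.toStage3Params.D → θ.toStage3Params.𝔸))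
        (H' : XSpace θ.toStage3Params.D i.k θ.toStage3Params.𝔸 →ₗ[ℂ] (Site θ.toStage3Params.D → θ.toStage3Params.𝔸)),
        (∀ x : Site θ.toStage3Params.D → θ.toStage3Params.𝔸, (∃ C : ℝ, ∀ y, ‖x y‖ ≤ C) → g (Δ x + qs (Aw (q x))) = x) ∧ (∀ φ, qs (c (q (g (g (qs φ))))) = qs φ) ∧
        (∀ (f : Site θ.toStage3Params.D → θ.toStage3Params.𝔸), ∀ x ∈ i.Ω 0, Δ f x = covLap i.η U₀ ((i.Ω 0).indicator f) x) ∧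
        (∀ (μ : ℕ → Site θ.toStage3Params.D → θ.toStage3Params.𝔸), ∀ x ∈ i.Ω 0, qs μ x = QT θ.toStage3Params.L i.k (i.Λs i.k) U₀ μ x) ∧
        (∀ (f : Site θ.toStage3Params.D → θ.toStage3Params.𝔸) (n : ℕ), n ≤ i.k → ∀ y ∈ i.Λs i.k n, q f n y = QprimeIter (zdBlocking θ.toStage3Params.D θ.toStage3Params.L) (bgT θ.toStage3Params.L U₀) n f y) ∧
        (∀ (f : Site θ.toStage3Params.D → θ.toStage3Params.𝔸) (n : ℕ) (y : Site θ.toStage3Params.D), ¬ (n ≤ i.k ∧ y ∈ i.Λs i.k n) → q f n y = 0) ∧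
        (∀ (X : XSpace θ.toStage3Params.D i.k θ.toStage3Params.𝔸) (x : Site θ.toStage3Params.D), ‖H' X x‖ ≤ B₀'H * ‖X‖) ∧
        (∀ n, n ≤ i.k → ∀ (X : XSpace θ.toStage3Params.D i.k θ.toStage3Params.𝔸), ∀ p ∈ {b : Site θ.toStage3Params.D × Fin θ.toStage3Params.D | SideTouches (i.Ω n) b.1 b.2},
          wt θ.toStage3Params.L i.η n * ‖covDerivFwd i.η U₀ p.2 (H' X) p.1‖ ≤ B₀'H * ‖X‖) ∧
        (∀ X : XSpace θ.toStage3Params.D i.k θ.toStage3Params.𝔸, Bd2 θ.toStage3Params.L i.η i.k i.Ω (covLap i.η U₀ (H' X)) (B₂' * ‖X‖)) ∧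
        (∀ (Y : XSpace θ.toStage3Params.D i.k θ.toStage3Params.𝔸) (n : ℕ) (hn : n ≤ i.k) (y : Site θ.toStage3Params.D), y ∈ i.Λs i.k n →
          QprimeIter (zdBlocking θ.toStage3Params.D θ.toStage3Params.L) (bgT θ.toStage3Params.L U₀) n (H' Y) y = Y (⟨n, Nat.lt_succ_of_le hn⟩, y)) ∧
        (∀ (f : Site θ.toStage3Params.D → θ.toStage3Params.𝔸) (r : ℝ), 0 ≤ r → Bd2 θ.toStage3Params.L i.η i.k i.Ω f r →
          (∀ x, ‖g f x‖ ≤ BG * r) ∧ ∀ n, n ≤ i.k → ∀ p ∈ {b : Site θ.toStage3Params.D × Fin θ.toStage3Params.D | SideTouches (i.Ω n) b.1 b.2},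
            wt θ.toStage3Params.L i.η n * ‖covDerivFwd i.η U₀ p.2 (g f) p.1‖ ≤ BG * r) ∧
        (∀ (f : Site θ.toStage3Params.D → θ.toStage3Params.𝔸) (r : ℝ), 0 ≤ r → Bd2 θ.toStage3Params.L i.η i.k i.Ω f r → Bd2 θ.toStage3Params.L i.η i.k i.Ω (f - g (qs (c (q (g f))))) (BR * r)))
    -- the SOURCELESS b9 socket of Proposition 3's frame over PRINT's class, at the law members only ([4] Thm 3.3; threshold `cB9`) — for Prop. 3 AS PRINTED
    (SB9P : ∀ i : ZdIdx θ.toStage3Params.D θ.toStage3Params.L, i.Ω 0 = Set.univ → IdxB8LawsB θ.toStage3Params.L i → B8ConstraintBonds.DomainSeq θ.toStage3Params.L i.Ω → (∀ l, l < i.k → ∀ z ∈ i.Λs i.k l, ((θ.toStage3Params.L : ℤ) ^ l) • z ∈ B8ConstraintBonds.Lam θ.toStage3Params.L i.Ω l) →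
      SockB9P3H2 (𝔸 := θ.toStage3Params.𝔸) θ.toStage3Params.L B₀ B₀β cB9 β len i.η i.k i.Ω i.Λs (fun m j => towerBondsP θ.toStage3Params.L i.Ω (i.Λs m) j))
    -- THEOREM 8's SOCKET-SIDE constants (source threshold `cP3`, source size factor `γ₈`, remainder slacks `γ′ γ″ γβ`) and the guard `2 ≤ 5dLB₀` on [4]'s `B₀` —
    -- NO layer equation, NO auxiliary `B₈ ∕ B₈β`, NO free-constant guard: those are CHOSEN ∕ DERIVED in the proof
    {cP3 γ₈ γ' γ'' γβ : ℝ} (hcP3 : 0 < cP3) (hγ₈ : 1 ≤ γ₈) (hγ' : 0 ≤ γ') (hγ'' : 0 ≤ γ'')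
    (hB : 2 ≤ 5 * (θ.toStage3Params.D : ℝ) * θ.toStage3Params.L * B₀) (hB₀β : 0 < B₀β)
    -- [Balaban1985BackgroundPropagators] Thm 3.3 WITH SOURCE in Theorem 4's frame at (1.146), γ′ letter, at the law members ONLY, asked RADIUS-UNIFORMLY: for every
    -- gauge-field radius scale `r ≥ 0` SOME threshold `c59 > 0` (print needs the one radius `r = O(B₁)`; [4] Thm 3.3 gives every `r` by shrinking its threshold) — HYPOTHESIS
    (SH59src : ∀ r : ℝ, 0 ≤ r → ∃ c59 : ℝ, 0 < c59 ∧ ∀ i : ZdIdx θ.toStage3Params.D θ.toStage3Params.L, i.Ω 0 = Set.univ → IdxB8LawsB θ.toStage3Params.L i → B8ConstraintBonds.DomainSeq θ.toStage3Params.L i.Ω → (∀ l, l < i.k → ∀ z ∈ i.Λs i.k l, ((θ.toStage3Params.L : ℤ) ^ l) • z ∈ B8ConstraintBonds.Lam θ.toStage3Params.L i.Ω l) → ∀ α₀ α₁ : ℝ, 0 < α₀ → 0 < α₁ → α₀ + α₁ ≤ c59 →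
      ∀ U₀ U' : Site θ.toStage3Params.D → Fin θ.toStage3Params.D → θ.toStage3Params.𝔸ˣ, (∀ x κ, U₀ x κ ∈ unitaryUnits θ.toStage3Params.𝔸) → (∀ x κ, U' x κ ∈ unitaryUnits θ.toStage3Params.𝔸) →
      ∀ φ : Site θ.toStage3Params.D → θ.toStage3Params.𝔸, ((InR138 θ.toStage3Params.L i.k i.η (i.Ω 0) (i.Λs i.k) U₀ φ ∧ (∀ x, IsSelfAdjoint (φ x)) ∧ (∀ x, x ∉ i.Ω 0 → φ x = 0) ∧
          Bdd θ.toStage3Params.L i.k i.η (-(2 : ℝ)) (fun j (x : Site θ.toStage3Params.D) => x ∈ i.Ω j) φ) ∧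
        msup θ.toStage3Params.L i.k i.η (-(2 : ℝ)) (fun j (x : Site θ.toStage3Params.D) => x ∈ i.Ω j) φ < γ₈ * (α₀ + α₁)) →
      InAk θ.toStage3Params.L i.k i.η α₀ i.Ω U₀ → InAk θ.toStage3Params.L i.k i.η α₀ i.Ω (mulCfg U' U₀) → (∀ m, m ≤ i.k → InAx θ.toStage3Params.L m (i.Λs m) U₀ (mulCfg U' U₀)) →
      (∀ j, j ≤ i.k → ∀ (z : Site θ.toStage3Params.D) (μ : Fin θ.toStage3Params.D),
        ((∀ x, InBox (tlo θ.toStage3Params.L z j) (thi θ.toStage3Params.L z j) x → x ∈ i.Ω j) ∨ (∀ x, InBox (tlo θ.toStage3Params.L (z + e μ) j) (thi θ.toStage3Params.L (z + e μ) j) x → x ∈ i.Ω j)) →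
        ‖(avgIter θ.toStage3Params.L (mulCfg U' U₀) j z μ : θ.toStage3Params.𝔸) - (avgIter θ.toStage3Params.L U₀ j z μ : θ.toStage3Params.𝔸)‖ ≤ α₁) →
      (∀ b ∈ {b : Site θ.toStage3Params.D × Fin θ.toStage3Params.D | SideTouches (i.Ω 0) b.1 b.2}, ‖((U' b.1 b.2 : θ.toStage3Params.𝔸ˣ) : θ.toStage3Params.𝔸) - 1‖ ≤ α₁) →
      (∀ m, 1 ≤ m → m ≤ i.k → ∀ (u : Site θ.toStage3Params.D → θ.toStage3Params.𝔸ˣ) (W : Site θ.toStage3Params.D → Fin θ.toStage3Params.D → θ.toStage3Params.𝔸ˣ) (A' : Site θ.toStage3Params.D → Fin θ.toStage3Params.D → θ.toStage3Params.𝔸),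
        (∀ x, u x ∈ unitaryUnits θ.toStage3Params.𝔸) → mgauge U₀ u W = U' → Restr129 θ.toStage3Params.L m (i.Λs m) U₀ u → LanF146 θ.toStage3Params.L i.k i.η (i.Ω 0) i.Λs U₀ φ m W →
        (∀ y τ, IsSelfAdjoint (A' y τ)) →
        (∀ j, j ≤ m → ∀ y τ, SideTouches (i.Ω j) y τ →
        W y τ = cfgExp i.η A' y τ ∧ ‖A' y τ‖ ≤ r * (α₀ + α₁) * ((θ.toStage3Params.L : ℝ) ^ j * i.η)⁻¹) →
        (∀ y τ, (∀ j, j ≤ m → ¬ SideTouches (i.Ω j) y τ) → A' y τ = 0) →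
        msup θ.toStage3Params.L m i.η (-(1 : ℝ)) (fun j (b : Site θ.toStage3Params.D × Fin θ.toStage3Params.D) => SideTouches (i.Ω j) b.1 b.2) (fun b => A' b.1 b.2)
        ≤ B₀ * (bondNorm θ.toStage3Params.L m i.η (-(3 : ℝ)) i.Ω (fun x μ => Jcur i.η U₀ A' μ x)
        + wsup 1 (fun p : {p : ℕ × (Site θ.toStage3Params.D × Fin θ.toStage3Params.D) // p.1 ≤ m ∧ p.2 ∈ towerBondsP θ.toStage3Params.L i.Ω (i.Λs m) p.1} =>
        linCovIter θ.toStage3Params.L U₀ (iEta i.η A') p.1.1 p.1.2.1 p.1.2.2)) + γ' * B₀ * (α₀ + α₁) ∧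
        msup θ.toStage3Params.L m i.η (-(2 : ℝ)) (fun j (t : Fin θ.toStage3Params.D × Fin θ.toStage3Params.D × Site θ.toStage3Params.D) => SideTouches (i.Ω j) t.2.2 t.2.1)
        (fun t => covDerivFwd i.η U₀ t.1 (fun z => A' z t.2.1) t.2.2)
        ≤ B₀ * (bondNorm θ.toStage3Params.L m i.η (-(3 : ℝ)) i.Ω (fun x μ => Jcur i.η U₀ A' μ x)
        + wsup 1 (fun p : {p : ℕ × (Site θ.toStage3Params.D × Fin θ.toStage3Params.D) // p.1 ≤ m ∧ p.2 ∈ towerBondsP θ.toStage3Params.L i.Ω (i.Λs m) p.1} =>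
        linCovIter θ.toStage3Params.L U₀ (iEta i.η A') p.1.1 p.1.2.1 p.1.2.2)) + γ' * B₀ * (α₀ + α₁)))
    -- THE SOURCED b9 SOCKET OF PROPOSITION 3's FRAME at the `Ω₀ = ℤᵈ` law members, threshold `cP3`, `|B₁|` over print's class at the top truncation — HYPOTHESIS
    -- ([Balaban1985BackgroundPropagators] Thm 3.3 with source; = `B8Prop3SrcZd3HPGamma`'s input letter for letter)
    (SB9srcHP : ∀ i : ZdIdx θ.toStage3Params.D θ.toStage3Params.L, i.Ω 0 = Set.univ → IdxB8LawsB θ.toStage3Params.L i → B8ConstraintBonds.DomainSeq θ.toStage3Params.L i.Ω → (∀ l, l < i.k → ∀ z ∈ i.Λs i.k l, ((θ.toStage3Params.L : ℤ) ^ l) • z ∈ B8ConstraintBonds.Lam θ.toStage3Params.L i.Ω l) → ∀ α₀ α₁ α₂ : ℝ, 0 < α₀ → α₀ ≤ cP3 → 0 < α₁ → 0 < α₂ → α₂ ≤ cP3 →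
      ∀ (U₀ W : Site θ.toStage3Params.D → Fin θ.toStage3Params.D → θ.toStage3Params.𝔸ˣ), (∀ x κ, U₀ x κ ∈ unitaryUnits θ.toStage3Params.𝔸) → (∀ x κ, W x κ ∈ unitaryUnits θ.toStage3Params.𝔸) →
      ∀ f : Site θ.toStage3Params.D → θ.toStage3Params.𝔸, InR138 θ.toStage3Params.L i.k i.η (i.Ω 0) (i.Λs i.k) U₀ f →
      (∀ x, IsSelfAdjoint (f x)) → (∀ x, x ∉ i.Ω 0 → f x = 0) →
      Bdd θ.toStage3Params.L i.k i.η (-(2 : ℝ)) (fun j (x : Site θ.toStage3Params.D) => x ∈ i.Ω j) f →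
      msup θ.toStage3Params.L i.k i.η (-(2 : ℝ)) (fun j (x : Site θ.toStage3Params.D) => x ∈ i.Ω j) f < γ₈ * (α₀ + α₁) →
      msup θ.toStage3Params.L i.k i.η (-(3 : ℝ)) (fun j (p : Fin θ.toStage3Params.D × Site θ.toStage3Params.D) => p.2 ∈ i.Ω j) (fun p => covDerivFwd i.η U₀ p.1 f p.2) < γ₈ * (α₀ + α₁) →
      InAk θ.toStage3Params.L i.k i.η α₀ i.Ω U₀ → InAk θ.toStage3Params.L i.k i.η α₀ i.Ω (mulCfg W U₀) → IsLandau146W θ.toStage3Params.L i.k i.η (i.Ω 0) (i.Λs i.k) U₀ f W →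
      ∀ A' : Site θ.toStage3Params.D → Fin θ.toStage3Params.D → θ.toStage3Params.𝔸, (∀ y τ, IsSelfAdjoint (A' y τ)) →
      (∀ j, j ≤ i.k → ∀ (y : Site θ.toStage3Params.D) (τ : Fin θ.toStage3Params.D), SideTouches (i.Ω j) y τ →
        W y τ = cfgExp i.η A' y τ ∧ ‖A' y τ‖ ≤ α₂ * ((θ.toStage3Params.L : ℝ) ^ j * i.η)⁻¹) →
      (∀ (y : Site θ.toStage3Params.D) (τ : Fin θ.toStage3Params.D), (∀ j, j ≤ i.k → ¬ SideTouches (i.Ω j) y τ) → A' y τ = 0) →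
      msup θ.toStage3Params.L i.k i.η (-(1 : ℝ)) (fun j (b : Site θ.toStage3Params.D × Fin θ.toStage3Params.D) => SideTouches (i.Ω j) b.1 b.2) (fun b => A' b.1 b.2)
          ≤ B₀ * (bondNorm θ.toStage3Params.L i.k i.η (-(3 : ℝ)) i.Ω (fun x μ => Jcur i.η U₀ A' μ x)
            + wsup 1 (fun p : {p : ℕ × (Site θ.toStage3Params.D × Fin θ.toStage3Params.D) // p.1 ≤ i.k ∧ p.2 ∈ towerBondsP θ.toStage3Params.L i.Ω (i.Λs i.k) p.1} =>
                linCovIter θ.toStage3Params.L U₀ (iEta i.η A') p.1.1 p.1.2.1 p.1.2.2)) + γ'' * B₀ * (α₀ + α₁) ∧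
        msup θ.toStage3Params.L i.k i.η (-(2 : ℝ)) (fun j (t : Fin θ.toStage3Params.D × Fin θ.toStage3Params.D × Site θ.toStage3Params.D) => SideTouches (i.Ω j) t.2.2 t.2.1)
            (fun t => covDerivFwd i.η U₀ t.1 (fun z => A' z t.2.1) t.2.2)
          ≤ B₀ * (bondNorm θ.toStage3Params.L i.k i.η (-(3 : ℝ)) i.Ω (fun x μ => Jcur i.η U₀ A' μ x)
            + wsup 1 (fun p : {p : ℕ × (Site θ.toStage3Params.D × Fin θ.toStage3Params.D) // p.1 ≤ i.k ∧ p.2 ∈ towerBondsP θ.toStage3Params.L i.Ω (i.Λs i.k) p.1} =>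
                linCovIter θ.toStage3Params.L U₀ (iEta i.η A') p.1.1 p.1.2.1 p.1.2.2)) + γ'' * B₀ * (α₀ + α₁) ∧
        bondNorm θ.toStage3Params.L i.k i.η (-(3 : ℝ)) i.Ω (fun x μ => pdiv i.η U₀ (plaqCovDeriv i.η U₀ A') μ x)
          ≤ B₀ * (bondNorm θ.toStage3Params.L i.k i.η (-(3 : ℝ)) i.Ω (fun x μ => Jcur i.η U₀ A' μ x)
            + wsup 1 (fun p : {p : ℕ × (Site θ.toStage3Params.D × Fin θ.toStage3Params.D) // p.1 ≤ i.k ∧ p.2 ∈ towerBondsP θ.toStage3Params.L i.Ω (i.Λs i.k) p.1} =>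
                linCovIter θ.toStage3Params.L U₀ (iEta i.η A') p.1.1 p.1.2.1 p.1.2.2)) + γ'' * B₀ * (α₀ + α₁) ∧
        bondNorm θ.toStage3Params.L i.k i.η (-(3 : ℝ)) i.Ω (fun x μ => covLap i.η U₀ (fun z => A' z μ) x)
          ≤ B₀ * (bondNorm θ.toStage3Params.L i.k i.η (-(3 : ℝ)) i.Ω (fun x μ => Jcur i.η U₀ A' μ x)
            + wsup 1 (fun p : {p : ℕ × (Site θ.toStage3Params.D × Fin θ.toStage3Params.D) // p.1 ≤ i.k ∧ p.2 ∈ towerBondsP θ.toStage3Params.L i.Ω (i.Λs i.k) p.1} =>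
                linCovIter θ.toStage3Params.L U₀ (iEta i.η A') p.1.1 p.1.2.1 p.1.2.2)) + γ'' * B₀ * (α₀ + α₁) ∧
        msup θ.toStage3Params.L i.k i.η (-(2 + β)) (fun j (q : Fin θ.toStage3Params.D × Fin θ.toStage3Params.D × (Site θ.toStage3Params.D × Site θ.toStage3Params.D)) => q.2.2 ∈ AdmPair i.η len ∧ q.2.2.1 ∈ i.Ω j ∧ q.2.2.2 ∈ i.Ω j)
            (fun q => hquot i.η β len U₀ (covDerivFwd i.η U₀ q.1 (fun z => A' z q.2.1)) q.2.2)
          ≤ B₀β * (bondNorm θ.toStage3Params.L i.k i.η (-(3 : ℝ)) i.Ω (fun x μ => Jcur i.η U₀ A' μ x)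
            + wsup 1 (fun p : {p : ℕ × (Site θ.toStage3Params.D × Fin θ.toStage3Params.D) // p.1 ≤ i.k ∧ p.2 ∈ towerBondsP θ.toStage3Params.L i.Ω (i.Λs i.k) p.1} =>
                linCovIter θ.toStage3Params.L U₀ (iEta i.η A') p.1.1 p.1.2.1 p.1.2.2)) + γβ * (α₀ + α₁)) :
    ∃ (lam : ResidB8 θ.toStage3Params) (c₁ : ℝ) (ρ₀ : ℕ) (w w' : WorldP), IsRecordOfRecord₁₃CSepCoPHSX3P₂DV F N (datumOfRecord₁₃SepCoPH F N θ h) w ∧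
      w.C = (datumOfRecord₁₃SepCoPH F N θ h).C ∧ w.γ = γw ∧ w.L = (θ.L : ℝ) ∧
      (∀ P : B12.RunParams, w.up P =
        upOfRecord₅CSC F N ((θ.pinX3P₂D F N (lam.cutSubBP₅ c₁ ρ₀) lam12 lam13).view₁₃CoPHB10YZW F N Mstar ops ζ lamW) (c₇OfRecord θ.toStage3Params) P) ∧
      (∀ P : B12.RunParams, (leavesP w P).b8 ∧ Dag.B8_main (leavesP w P)) ∧
      IsRecordOfRecord₁₃CSepCoPH F N (datumOfRecord₁₃SepCoPH F N θ h) w' ∧ w'.C = w.C ∧ w'.γ = w.γ ∧ w'.L = w.L ∧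
      ∀ P : B12.RunParams, leavesP w P = { leavesP w' P with b8 := (leavesP w P).b8 } := by
  obtain ⟨lam, c₁, ρ₀, hslot⟩ := exists_residB8_b8LeafOfRecordSubBP₂D_cutSubBP₅_of_lettersSrc_γ' θ.toStage3Params (hθ.toStage9.toStage8).1.1.1.1 hL5
    hcB9 hB₀'H hB₂' hBG hBR hcL SLet SLetUB SB9P hcP3 hγ₈ hγ' hγ'' hB hB₀β SH59src SB9srcHP
  exact ⟨lam, c₁, ρ₀, exists_isRecordOfRecord₁₃CSepCoPHSX3P₂DV_b8_of_leaf θ h hθ lam12 lam13 Mstar ops ζ lamW (lam.cutSubBP₅ c₁ ρ₀) hslot hγ0 hγ1⟩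

end AtXView

end Summit.QuantumFields.YangMills.BalabanUVNodes.N05AtXPinnedP2DSViewSepCoPHOfSocketsGammaPrime

end
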